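import Summits.Ventures.PackingBounds.Energy.FivePointRieszThree
import Summits.Ventures.PackingBounds.Configurations.FivePointConfigs
import HarnessLib

/-!
# Five points on `S²`, Riesz 3-energy: the two-sided statement

Framing: lottery ticket; floor = certified bounds/negative ranges. Venture `PackingBounds`, cell
`pub-packcert`, energy family E3PT (pub-packcert-energy gen 12).

Combines the kernel-checked sharp three-point bound `FivePointRieszThree.riesz_three_five_points`
(`Σ_{x ≠ y} 1/‖x-y‖³ ≥ 1/4 + 3√2 + (2/3)√3` for every five unit vectors of `ℝ³`; exact d = 6 certificate over
`ℚ(√2,√3)`, `e3pt-sharp-n3N5s3d6K-none.json`, 77 × 77 Gram block by kernel evaluation on integer data)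
with the explicit triangular bipyramid `Config.Bipyramid.pts` (distances `2` once, `√2` six times, `√3`
three times among unordered pairs): the minimum of the Riesz 3-energy of five points on `S²` is exactly
`1/4 + 3√2 + (2/3)√3` (ordered pairs), attained by the triangular bipyramid (R. E. Schwartz,
arXiv:2301.05090; here by an exact SDP certificate).
-/

noncomputable section

open Finset
open scoped RealInnerProductSpace

namespace Summit.Ventures.PackingBounds.Energy.FivePointRieszThree

open Summit.Ventures.PackingBounds.Config

/-- The triangular bipyramid has Riesz 3-energy `1/4 + 3√2 + (2/3)√3` over ordered pairs
(`2·(1/8) + 12·(1/(2√2)) + 6·(1/(3√3))`). -/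
theorem bipyramid_riesz_three_energy :
    ∑ x ∈ Bipyramid.pts, ∑ y ∈ Bipyramid.pts.erase x, 1 / ‖x - y‖ ^ 3 =
      1 / 4 + 3 * Real.sqrt 2 + 2 / 3 * Real.sqrt 3 := by
  have h : ∀ x ∈ Bipyramid.pts, ∀ y ∈ Bipyramid.pts.erase x,
      1 / ‖x - y‖ ^ 3 = (fun t : ℝ => 1 / Real.sqrt (2 - 2 * t) ^ 3) (inner ℝ x y) := by
    intro x hx y hy
    have hyC : y ∈ Bipyramid.pts := Finset.mem_of_mem_erase hy
    have hn : ‖x - y‖ ^ 2 = 2 - 2 * inner ℝ x y := by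
      rw [@norm_sub_sq_real, Bipyramid.norm_pts x hx, Bipyramid.norm_pts y hyC]; ring
    have hxy : ‖x - y‖ = Real.sqrt (2 - 2 * inner ℝ x y) := by
      rw [← hn, Real.sqrt_sq (norm_nonneg _)]
    simp only [hxy]
  have e := Bipyramid.energy_pts (fun t : ℝ => 1 / Real.sqrt (2 - 2 * t) ^ 3)
  rw [Finset.sum_congr rfl fun x hx => Finset.sum_congr rfl fun y hy => h x hx y hy, e]
  show 2 * (1 / Real.sqrt (2 - 2 * (-1 : ℝ)) ^ 3 + 3 * (1 / Real.sqrt (2 - 2 * 0) ^ 3))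
      + 3 * (2 * (1 / Real.sqrt (2 - 2 * 0) ^ 3) + 2 * (1 / Real.sqrt (2 - 2 * (-1 / 2 : ℝ)) ^ 3)) = _
  have h4 : Real.sqrt (2 - 2 * (-1 : ℝ)) = 2 := by
    rw [show (2 : ℝ) - 2 * (-1 : ℝ) = 2 ^ 2 by norm_num, Real.sqrt_sq (by norm_num : (0 : ℝ) ≤ 2)]
  have h0 : Real.sqrt (2 - 2 * (0 : ℝ)) = Real.sqrt 2 := by norm_num
  have hh : Real.sqrt (2 - 2 * (-1 / 2 : ℝ)) = Real.sqrt 3 := by norm_num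
  have m2 : Real.sqrt 2 * Real.sqrt 2 = 2 := Real.mul_self_sqrt (by norm_num)
  have m3 : Real.sqrt 3 * Real.sqrt 3 = 3 := Real.mul_self_sqrt (by norm_num)
  have e2 : Real.sqrt 2 ^ 3 = 2 * Real.sqrt 2 := by rw [pow_succ, pow_two, m2]
  have e3 : Real.sqrt 3 ^ 3 = 3 * Real.sqrt 3 := by rw [pow_succ, pow_two, m3]
  have k2 : 1 / (2 * Real.sqrt 2) = Real.sqrt 2 / 4 := by
    rw [div_eq_div_iff (by positivity) (by norm_num), one_mul, mul_left_comm, m2]; norm_num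
  have k3 : 1 / (3 * Real.sqrt 3) = Real.sqrt 3 / 9 := by
    rw [div_eq_div_iff (by positivity) (by norm_num), one_mul, mul_left_comm, m3]; norm_num
  rw [h4, h0, hh, e2, e3, k2, k3]
  ring

/-- **Five points on `S²`, Riesz 3-energy, two-sided:** the least value of `Σ_{x ≠ y} 1/‖x-y‖³`
over five unit vectors of `ℝ³` is `1/4 + 3√2 + (2/3)√3`, attained by the triangular bipyramid. -/
theorem riesz_three_five_points_isLeast :
    IsLeast {E : ℝ | ∃ C : Finset (EuclideanSpace ℝ (Fin 3)), C.card = 5 ∧ (∀ x ∈ C, ‖x‖ = 1) ∧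
      E = ∑ x ∈ C, ∑ y ∈ C.erase x, 1 / ‖x - y‖ ^ 3} (1 / 4 + 3 * Real.sqrt 2 + 2 / 3 * Real.sqrt 3) := by
  refine ⟨⟨Bipyramid.pts, Bipyramid.card_pts, Bipyramid.norm_pts, bipyramid_riesz_three_energy.symm⟩, ?_⟩
  rintro E ⟨C, h5, hC, rfl⟩
  simpa using riesz_three_five_points C hC h5

end Summit.Ventures.PackingBounds.Energy.FivePointRieszThree
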